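import Literature.Computability.QuantumComplexity.PauliParseval
import Literature.Computability.QuantumComplexity.PauliPathIntegral
import Mathlib.Algebra.BigOperators.Ring.Finset
import HarnessLib

/-!
# Classical shadows from random Pauli-basis measurements (Huang–Kueng–Preskill 2020)

H.-Y. Huang, R. Kueng, J. Preskill, *Predicting many properties of a quantum system from very few
measurements*, Nature Phys. 16 (2020) 1050–1057, arXiv:2002.08953 [HuangKuengPreskill2020]:
measure every qubit of an `n`-qubit state `ρ` in a uniformly random Pauli basis `b ∈ {X,Y,Z}^n`
(main text: "equivalent to measuring each qubit independently in a random Pauli basis"), record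
the outcome signs `s ∈ {0,1}^n`, and form the **classical shadow** `ρ̂(b,s) = ⊗ⱼ (3 Π_{bⱼ,sⱼ} − 1)`,
`Π_{Q,t} = (1 + (−1)^t σ_Q)/2` (Supplementary Information §5.C, Proposition S2 — "Proposition 2"
of the held TeX text §14.3: `ρ̂ = ⊗ⱼ (3Uⱼ†|b̂ⱼ⟩⟨b̂ⱼ|Uⱼ − 𝕀)`, `𝓜⁻¹ = (𝒟_{1/3}⁻¹)^{⊗n}`,
`𝒟_{1/3}⁻¹(Y) = 3Y − tr(Y)𝕀`).

Over the vocabulary of `Literature/Computability/QuantumComplexity/PauliExpansion.lean`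
(`Pauli`, `tensorAll`, `pauliString`, `pauliCoeff`) this file PROVES the exact moment identities
of the estimator, by finite enumeration over the `3^n · 2^n` records `(b, s)` weighted with
`prob ρ b s = 3^{-n} Tr(Π_{b,s} ρ)` (all linear in `ρ`, so stated for every complex matrix `ρ`):

* `expect_snapshot` — **unbiasedness** `Σ_{b,s} prob ρ b s • ρ̂(b,s) = ρ` (main text `𝔼[ρ̂] = ρ`);
* `pauliCoeff_snapshot` — letterwise post-processing
  `Tr(σ_S ρ̂(b,s)) = ∏ᵢ ([Sᵢ = I] + 3(−1)^{sᵢ}[Sᵢ = bᵢ])` (§5.C: `𝒟_{1/3}⁻¹(P) = 3P`);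
* `expect_pauliEst` — `𝔼[Tr(σ_S ρ̂)] = Tr(σ_S ρ)`; `expect_pauliEst_sq` — **the `3^k` law**
  `𝔼[Tr(σ_S ρ̂)²] = 3^{|S|} Tr ρ`, `|S|` = number of non-identity letters (§5.C Lemma S3,
  "Lemma 3" of the held text: `‖σ_S‖²_shadow = 3^k`, here for every `ρ`, not only the maximiser);
  `variance_pauliEst` (`Var = 3^{|S|} − Tr(σ_S ρ)²` for `Tr ρ = 1`) and `variance_pauliEst_re_le`
  (`Var ≤ 3^{|S|}`, Hermitian unit-trace `ρ`; SI §1.B Lemma S1 with Lemma S3) — the input to the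
  `O(3^k log(M)/ε²)` sample count of HKP Theorem 1 for `k`-local Pauli observables.

No named facts.  NOT here: random-Clifford shadows (SI §5.B), the `4^k‖O‖²_∞` bound (Prop. S3),
median of means (Thm. S1).  Refs: [HuangKuengPreskill2020] doi:10.1038/s41567-020-0932-7 =
arXiv:2002.08953 (main text; SI §1.A–B Lemma S1; §5.C Prop. S2, Lemma S3); Pauli vocabulary
[KempeEtAl2010] (`PauliExpansion.lean`), completeness [AharonovEtAl2023] (`PauliPathIntegral`).
-/

noncomputable section

open Matrix Finset Literature.Computability.QuantumComplexity

namespace Literature.InformationTheory.QuantumLearning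

namespace PauliShadow

variable {ι : Type*} [Fintype ι] [DecidableEq ι]

/-! ### One qubit: outcome signs, eigenprojectors, the snapshot `3Π − 1` -/

/-- The sign `(−1)^t` of a measurement outcome bit (`false ↦ +1`, `true ↦ −1`). [folklore] -/
def sgn (t : Bool) : ℂ := if t then -1 else 1

/-- `sgn true = −1`. [folklore] -/
@[simp] private theorem sgn_true : sgn true = -1 := by simp [sgn]

/-- `sgn false = 1`. [folklore] -/
@[simp] private theorem sgn_false : sgn false = 1 := by simp [sgn]

/-- `sgn t² = 1`. [folklore] -/
private theorem sgn_mul_self (t : Bool) : sgn t * sgn t = 1 := by cases t <;> simp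

/-- The eigenprojector `Π_{Q,t} = (1 + (−1)^t σ_Q)/2` of the basis `Q ∈ {X,Y,Z}`, eigenvalue
`(−1)^t`: the post-measurement state `U_j†|b̂_j⟩⟨b̂_j|U_j` of a qubit measured in basis `Q` with
outcome `t` (junk for `Q = I`). [cite: HuangKuengPreskill2020, SI §5.C Proposition S2] -/
def proj (Q : Pauli) (t : Bool) : Matrix Bool Bool ℂ :=
  (1 / 2 : ℂ) • (1 + sgn t • Q.mat)

/-- Resolution of the identity in each basis: `Π_{Q,0} + Π_{Q,1} = 1`.
[cite: HuangKuengPreskill2020, SI §5.C proof of Proposition S2 (Σ_{b_j} U_j†|b_j⟩⟨b_j|U_j)] -/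
theorem sum_proj (Q : Pauli) : ∑ t, proj Q t = 1 := by
  rw [Fintype.sum_bool]
  ext a b
  cases Q <;> cases a <;> cases b <;>
    simp [proj, Matrix.add_apply, Matrix.smul_apply] <;> norm_num

/-- Spectral decomposition of a Pauli matrix: `Π_{Q,0} − Π_{Q,1} = σ_Q`. [folklore] -/
private theorem sum_sgn_smul_proj (Q : Pauli) : ∑ t, sgn t • proj Q t = Q.mat := by
  rw [Fintype.sum_bool]
  ext a b
  cases Q <;> cases a <;> cases b <;>
    simp [proj, Matrix.add_apply, Matrix.smul_apply] <;> ring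

/-- A basis projector has unit trace: `Tr Π_{Q,t} = 1` (`Q ≠ I`). [folklore] -/
private theorem trace_proj {Q : Pauli} (hQ : Q ≠ Pauli.I) (t : Bool) : (proj Q t).trace = 1 := by
  rw [Matrix.trace, Fintype.sum_bool, Matrix.diag_apply, Matrix.diag_apply]
  cases Q <;> cases t <;>
    simp [proj, Matrix.add_apply, Matrix.smul_apply] at hQ ⊢ <;> norm_num

/-- The one-qubit snapshot `3 Π_{Q,t} − 1 = 𝒟_{1/3}⁻¹(Π_{Q,t})`, `𝒟_{1/3}⁻¹(Y) = 3Y − tr(Y)·1`.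
[cite: HuangKuengPreskill2020, Supplementary §5.C Proposition S2 (ρ̂ = ⊗ⱼ(3Uⱼ†|b̂ⱼ⟩⟨b̂ⱼ|Uⱼ − 𝕀))] -/
def qubitSnapshot (Q : Pauli) (t : Bool) : Matrix Bool Bool ℂ :=
  (3 : ℂ) • proj Q t - 1

/-- The one-qubit snapshot has unit trace (`Q ≠ I`). [folklore] -/
private theorem trace_qubitSnapshot {Q : Pauli} (hQ : Q ≠ Pauli.I) (t : Bool) :
    (qubitSnapshot Q t).trace = 1 := by
  rw [qubitSnapshot, Matrix.trace_sub, Matrix.trace_smul, trace_proj hQ, Matrix.trace_one,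
    Fintype.card_bool, smul_eq_mul]
  norm_num

/-- Pauli letters against the one-qubit snapshot, for a basis `Q ≠ I`:
`Tr(σ_P (3Π_{Q,t} − 1)) = [P = I] + 3(−1)^t [P = Q]` (`𝒟_{1/3}⁻¹(σ_P) = 3σ_P`).
[cite: HuangKuengPreskill2020, SI §5.C proof of Lemma S3 (𝒟_{1/3}⁻¹(P_{p_j}) = 3P_{p_j})] -/
theorem trace_mat_mul_qubitSnapshot (P : Pauli) {Q : Pauli} (hQ : Q ≠ Pauli.I) (t : Bool) :
    (P.mat * qubitSnapshot Q t).trace =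
      if P = Pauli.I then 1 else if P = Q then 3 * sgn t else 0 := by
  rw [Matrix.trace, Fintype.sum_bool, Matrix.diag_apply, Matrix.diag_apply, Pauli.mul_apply_bool,
    Pauli.mul_apply_bool]
  cases P <;> cases Q <;> first
    | exact absurd rfl hQ
    | (cases t <;>
        simp [qubitSnapshot, proj, Matrix.sub_apply, Matrix.add_apply, Matrix.smul_apply] <;>
        ring_nf <;> simp [Complex.I_sq])

/-! ### The measurement bases and settings -/

/-- The three measurement bases `{X, Y, Z}`. [cite: HuangKuengPreskill2020, main text
("measuring each qubit independently in a random Pauli basis")] -/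
def bases : Finset Pauli := {Pauli.X, Pauli.Y, Pauli.Z}

/-- `Q` is a basis iff `Q ≠ I`. [folklore] -/
private theorem mem_bases {Q : Pauli} : Q ∈ bases ↔ Q ≠ Pauli.I := by cases Q <;> decide

/-- Sums over the bases, unfolded. [folklore] -/
private theorem sum_bases {M : Type*} [AddCommMonoid M] (f : Pauli → M) :
    ∑ Q ∈ bases, f Q = f Pauli.X + f Pauli.Y + f Pauli.Z := by
  rw [bases, Finset.sum_insert (by decide), Finset.sum_insert (by decide), Finset.sum_singleton,
    add_assoc]

/-- There are three bases. [folklore] -/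
private theorem card_bases : bases.card = 3 := by decide

/-- The measurement settings of a register: a basis for every wire, `{X,Y,Z}^ι`.
[cite: HuangKuengPreskill2020, Supplementary §5.C Proposition S2 (U = U₁ ⊗ ⋯ ⊗ Uₙ)] -/
def settings : Finset (ι → Pauli) :=
  Fintype.piFinset fun _ => bases

/-- A word is a setting iff it has no identity letter.
[cite: HuangKuengPreskill2020, main text ("random Pauli basis" X, Y or Z for each qubit)] -/
theorem mem_settings {b : ι → Pauli} :
    b ∈ (settings : Finset (ι → Pauli)) ↔ ∀ i, b i ≠ Pauli.I := by
  simp only [settings, Fintype.mem_piFinset, mem_bases]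

/-- There are `3^{|ι|}` settings.
[cite: HuangKuengPreskill2020, main text ("random Pauli basis" X, Y or Z for each qubit)] -/
theorem card_settings : (settings : Finset (ι → Pauli)).card = 3 ^ Fintype.card ι := by
  rw [settings, Fintype.card_piFinset, Finset.prod_const, card_bases, Finset.card_univ]

/-! ### Registers: POVM elements, Born weights, the record law, snapshots -/

/-- The POVM element `Π_{b,s} = ⊗ᵢ Π_{bᵢ,sᵢ}` of setting `b` and outcome string `s`.
[cite: HuangKuengPreskill2020, Supplementary §1.A (Born's rule for U†|b̂⟩⟨b̂|U) and §5.C] -/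
def povm (b : ι → Pauli) (s : ι → Bool) : Matrix (ι → Bool) (ι → Bool) ℂ :=
  tensorAll fun i => proj (b i) (s i)

/-- The Born weight `Tr(Π_{b,s} ρ)` — for a density matrix `ρ`, the probability of outcome `s`
when measuring in setting `b`. [cite: HuangKuengPreskill2020, Supplementary §1.A (Born's rule)] -/
def bornWeight (ρ : Matrix (ι → Bool) (ι → Bool) ℂ) (b : ι → Pauli) (s : ι → Bool) : ℂ :=
  (povm b s * ρ).trace

/-- The weight of the record `(b, s)`: setting uniform among the `3^{|ι|}`, then Born,
`prob ρ b s = 3^{-|ι|} · Tr(Π_{b,s} ρ)`. [cite: HuangKuengPreskill2020, Supplementary §1.A] -/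
def prob (ρ : Matrix (ι → Bool) (ι → Bool) ℂ) (b : ι → Pauli) (s : ι → Bool) : ℂ :=
  (1 / 3 : ℂ) ^ Fintype.card ι * bornWeight ρ b s

/-- The **classical shadow** (snapshot) of the record `(b, s)`: `ρ̂(b,s) = ⊗ᵢ (3 Π_{bᵢ,sᵢ} − 1)`.
[cite: HuangKuengPreskill2020, Supplementary §5.C Proposition S2 (closed-form classical shadow)] -/
def snapshot (b : ι → Pauli) (s : ι → Bool) : Matrix (ι → Bool) (ι → Bool) ℂ :=
  tensorAll fun i => qubitSnapshot (b i) (s i)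

/-- The shadow estimate of a Pauli observable `σ_S`, in closed form — a product of one number per
letter: `1` on identity letters, `3 (−1)^{sᵢ}` where the setting hits the letter, `0` otherwise.
[cite: HuangKuengPreskill2020, Supplementary §5.C proof of Lemma S3] -/
def pauliEst (S b : ι → Pauli) (s : ι → Bool) : ℂ :=
  ∏ i, if S i = Pauli.I then 1 else if S i = b i then 3 * sgn (s i) else 0

/-- Summing a product-form function over all outcome strings factorises wire by wire. [folklore] -/
private theorem sum_smul_tensorAll (f : ι → Bool → ℂ) (A : ι → Bool → Matrix Bool Bool ℂ) :
    ∑ s : ι → Bool, (∏ i, f i (s i)) • tensorAll (fun i => A i (s i)) =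
      tensorAll fun i => ∑ t, f i t • A i t := by
  ext x y
  simp only [Matrix.sum_apply, Matrix.smul_apply, smul_eq_mul, tensorAll_apply,
    ← Finset.prod_mul_distrib]
  exact (Fintype.prod_sum fun i t => f i t * A i t (x i) (y i)).symm

/-- Summing a product-form scalar over all records `(b, s)` factorises wire by wire:
`Σ_{b ∈ {X,Y,Z}^ι} Σ_s ∏ᵢ g i bᵢ sᵢ = ∏ᵢ Σ_{Q ∈ {X,Y,Z}} Σ_t g i Q t`. [folklore] -/
private theorem sum_settings_sum_prod (g : ι → Pauli → Bool → ℂ) :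
    ∑ b ∈ (settings : Finset (ι → Pauli)), ∑ s : ι → Bool, ∏ i, g i (b i) (s i) =
      ∏ i, ∑ Q ∈ bases, ∑ t, g i Q t := by
  rw [settings, ← Finset.sum_prod_piFinset bases (fun i Q => ∑ t, g i Q t)]
  refine Finset.sum_congr rfl fun b _ => ?_
  exact (Fintype.prod_sum fun i t => g i (b i) t).symm

/-- Matrix form of per-wire averaging over records:
`Σ_{b,s} (∏ᵢ f i bᵢ sᵢ) • ⊗ᵢ A i bᵢ sᵢ = ⊗ᵢ (Σ_{Q,t} f i Q t • A i Q t)` — the tensor-product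
structure "factorizes completely" (HKP).
[cite: HuangKuengPreskill2020, Supplementary §5.C proof of Proposition S2 (𝓜 = 𝒟_{1/3}^{⊗n})] -/
theorem sum_settings_sum_smul_tensorAll (f : ι → Pauli → Bool → ℂ)
    (A : ι → Pauli → Bool → Matrix Bool Bool ℂ) :
    ∑ b ∈ (settings : Finset (ι → Pauli)), ∑ s : ι → Bool,
        (∏ i, f i (b i) (s i)) • tensorAll (fun i => A i (b i) (s i)) =
      tensorAll fun i => ∑ Q ∈ bases, ∑ t, f i Q t • A i Q t := by
  ext x y
  simp only [Matrix.sum_apply, Matrix.smul_apply, smul_eq_mul, tensorAll_apply,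
    ← Finset.prod_mul_distrib]
  exact sum_settings_sum_prod (fun i Q t => f i Q t * A i Q t (x i) (y i))

omit [DecidableEq ι] in
/-- A tensor product of scalar matrices is a scalar matrix. [folklore] -/
private theorem tensorAll_smul_one (c : ι → ℂ) :
    tensorAll (fun i => c i • (1 : Matrix Bool Bool ℂ)) =
      (∏ i, c i) • (1 : Matrix (ι → Bool) (ι → Bool) ℂ) := by
  rw [← tensorAll_one (ι := ι)]
  ext x y
  simp only [tensorAll_apply, Matrix.smul_apply, smul_eq_mul, ← Finset.prod_mul_distrib]

/-- The POVM of every setting is complete: `Σ_s Π_{b,s} = 1`.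
[cite: HuangKuengPreskill2020, SI §1.A (Born's rule for the measurement U†|b̂⟩⟨b̂|U)] -/
theorem sum_povm (b : ι → Pauli) : ∑ s : ι → Bool, povm b s = 1 := by
  have h := sum_smul_tensorAll (fun (_ : ι) (_ : Bool) => (1 : ℂ)) (fun i t => proj (b i) t)
  simp only [Finset.prod_const_one, one_smul, sum_proj] at h
  simpa [povm, tensorAll_one] using h

/-- The Born weights of every setting sum to `Tr ρ` (= 1 for a density matrix).
[cite: HuangKuengPreskill2020, SI §1.A (Born's rule for the measurement U†|b̂⟩⟨b̂|U)] -/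
theorem sum_bornWeight (ρ : Matrix (ι → Bool) (ι → Bool) ℂ) (b : ι → Pauli) :
    ∑ s, bornWeight ρ b s = ρ.trace := by
  simp only [bornWeight, ← Matrix.trace_sum, ← Matrix.sum_mul, sum_povm, Matrix.one_mul]

/-- The snapshot has unit trace. [cite: HuangKuengPreskill2020, SI §5.C Proposition S2] -/
theorem trace_snapshot {b : ι → Pauli} (hb : b ∈ (settings : Finset (ι → Pauli)))
    (s : ι → Bool) : (snapshot b s).trace = 1 := by
  rw [snapshot, trace_tensorAll]
  exact Finset.prod_eq_one fun i _ => trace_qubitSnapshot (mem_settings.1 hb i) (s i)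

/-! ### Expectations of product-form statistics -/

/-- **Averaging a product-form statistic** `∏ᵢ e i bᵢ sᵢ` against the record law moves it into the
POVM: `Tr((⊗ᵢ Σ_{Q,t} (e i Q t/3) Π_{Q,t}) ρ)`. [cite: HuangKuengPreskill2020, SI §5.C, Lemma S3] -/
theorem expect_prod (ρ : Matrix (ι → Bool) (ι → Bool) ℂ) (e : ι → Pauli → Bool → ℂ) :
    ∑ b ∈ settings, ∑ s, prob ρ b s * ∏ i, e i (b i) (s i) =
      ((tensorAll fun i => ∑ Q ∈ bases, ∑ t, ((1 / 3 : ℂ) * e i Q t) • proj Q t) * ρ).trace := by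
  rw [← sum_settings_sum_smul_tensorAll, Matrix.sum_mul, Matrix.trace_sum]
  refine Finset.sum_congr rfl fun b _ => ?_
  rw [Matrix.sum_mul, Matrix.trace_sum]
  refine Finset.sum_congr rfl fun s _ => ?_
  rw [Matrix.smul_mul, Matrix.trace_smul, smul_eq_mul, prob, bornWeight, povm,
    Finset.prod_mul_distrib, Finset.prod_const, Finset.card_univ]
  ring

/-- One wire of the first moment: `Σ_{Q ∈ {X,Y,Z}} Σ_t (e_P(Q,t)/3) Π_{Q,t} = σ_P`, where
`e_P(Q,t) = [P = I] + 3(−1)^t [P = Q]`. [cite: HuangKuengPreskill2020, SI §5.C (𝒟⁻¹(P) = 3P)] -/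
theorem wire_mean (P : Pauli) :
    ∑ Q ∈ bases, ∑ t,
        ((1 / 3 : ℂ) * (if P = Pauli.I then 1 else if P = Q then 3 * sgn t else 0)) • proj Q t =
      P.mat := by
  by_cases hP : P = Pauli.I
  · subst hP
    simp only [if_true, mul_one, ← Finset.smul_sum, sum_proj]
    rw [sum_bases, show Pauli.I.mat = 1 from rfl]
    ext a c
    cases a <;> cases c <;> simp [Matrix.smul_apply, Matrix.add_apply] <;> norm_num
  · simp only [hP, if_false]
    rw [Finset.sum_eq_single_of_mem P (mem_bases.2 hP) (fun Q _ hQP => by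
      simp [Ne.symm hQP])]
    simp only [if_true]
    have h3 : ∀ t, (1 / 3 : ℂ) * (3 * sgn t) = sgn t := fun t => by ring
    simp only [h3, sum_sgn_smul_proj]

/-- One wire of the second moment: `Σ_{Q ∈ {X,Y,Z}} Σ_t (e_P(Q,t)²/3) Π_{Q,t} = 3^{[P ≠ I]} · 1`.
[cite: HuangKuengPreskill2020, Supplementary §5.C proof of Lemma S3 (⊗ⱼ 3𝕀)] -/
theorem wire_sq (P : Pauli) :
    ∑ Q ∈ bases, ∑ t,
        ((1 / 3 : ℂ) * (if P = Pauli.I then 1 else if P = Q then 9 else 0)) • proj Q t =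
      (if P = Pauli.I then (1 : ℂ) else 3) • (1 : Matrix Bool Bool ℂ) := by
  by_cases hP : P = Pauli.I
  · subst hP
    simp only [if_true, mul_one, ← Finset.smul_sum, sum_proj, one_smul]
    rw [sum_bases]
    ext a c
    cases a <;> cases c <;> simp [Matrix.smul_apply, Matrix.add_apply] <;> norm_num
  · simp only [hP, if_false]
    rw [Finset.sum_eq_single_of_mem P (mem_bases.2 hP) (fun Q _ hQP => by
      simp [Ne.symm hQP])]
    simp only [if_true, ← Finset.smul_sum, sum_proj]
    norm_num

omit [DecidableEq ι] in
/-- `∏ᵢ 3^{[Sᵢ ≠ I]} = 3^{|S|}`. [folklore] -/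
private theorem prod_ite_eq_pow_strWeight (S : ι → Pauli) :
    ∏ i, (if S i = Pauli.I then (1 : ℂ) else 3) = 3 ^ PauliPath.strWeight S := by
  rw [Finset.prod_ite, Finset.prod_const_one, one_mul, Finset.prod_const, PauliPath.strWeight_eq]

/-! ### The estimator and its first two moments -/

/-- **Efficient post-processing**: the shadow estimate of a Pauli observable is the letterwise
product `Tr(σ_S ρ̂(b,s)) = ∏ᵢ ([Sᵢ = I] + 3(−1)^{sᵢ}[Sᵢ = bᵢ])`.
[cite: HuangKuengPreskill2020, Supplementary §5.C Proposition S2 and proof of Lemma S3] -/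
theorem pauliCoeff_snapshot {b : ι → Pauli} (hb : b ∈ (settings : Finset (ι → Pauli)))
    (S : ι → Pauli) (s : ι → Bool) : pauliCoeff (snapshot b s) S = pauliEst S b s := by
  rw [pauliCoeff_eq, pauliString_eq, snapshot, tensorAll_mul, trace_tensorAll, pauliEst]
  refine Finset.prod_congr rfl fun i _ => ?_
  exact trace_mat_mul_qubitSnapshot (S i) (mem_settings.1 hb i) (s i)

/-- **Unbiasedness for Pauli observables**: `𝔼[Tr(σ_S ρ̂)] = Tr(σ_S ρ)`, i.e.
`Σ_{b,s} prob ρ b s · pauliEst S b s = pauliCoeff ρ S`, for every matrix `ρ`.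
[cite: HuangKuengPreskill2020, Supplementary §1.B (𝔼 ô = tr(Oρ)) with §5.C Proposition S2] -/
theorem expect_pauliEst (ρ : Matrix (ι → Bool) (ι → Bool) ℂ) (S : ι → Pauli) :
    ∑ b ∈ settings, ∑ s, prob ρ b s * pauliEst S b s = pauliCoeff ρ S := by
  unfold pauliEst
  rw [expect_prod ρ (fun i Q t => if S i = Pauli.I then 1 else if S i = Q then 3 * sgn t else 0)]
  simp only [wire_mean, pauliCoeff_eq, pauliString_eq]

/-- **Unbiasedness**: `𝔼[ρ̂] = ρ` — `Σ_{b,s} prob ρ b s • ρ̂(b,s) = ρ` for every matrix `ρ`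
(the defining property of the classical shadow: `𝓜⁻¹` inverts the measurement channel).
[cite: HuangKuengPreskill2020, main text (𝔼[ρ̂] = ρ) and Supplementary §1.A, §5.C Proposition S2] -/
theorem expect_snapshot (ρ : Matrix (ι → Bool) (ι → Bool) ℂ) :
    ∑ b ∈ settings, ∑ s, prob ρ b s • snapshot b s = ρ := by
  refine PauliPath.eq_of_forall_pauliCoeff_eq fun S => ?_
  rw [pauliCoeff_sum, ← expect_pauliEst ρ S]
  refine Finset.sum_congr rfl fun b hb => ?_
  rw [pauliCoeff_sum]
  refine Finset.sum_congr rfl fun s _ => ?_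
  rw [pauliCoeff_smul, pauliCoeff_snapshot hb]

/-- The record weights sum to `Tr ρ` (= 1 for a density matrix).
[cite: HuangKuengPreskill2020, SI §1.A (Born's rule for the measurement U†|b̂⟩⟨b̂|U)] -/
theorem sum_prob (ρ : Matrix (ι → Bool) (ι → Bool) ℂ) :
    ∑ b ∈ settings, ∑ s, prob ρ b s = ρ.trace := by
  simpa [pauliEst] using expect_pauliEst ρ (fun _ => Pauli.I)

/-- **The `3^k` law** (second moment): `𝔼[Tr(σ_S ρ̂)²] = 3^{|S|} · Tr ρ` for every matrix `ρ`,
`|S|` the number of non-identity letters — for states, the squared shadow norm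
`‖σ_S‖²_shadow = 3^k` of a `k`-local Pauli observable, attained by every state.
[cite: HuangKuengPreskill2020, SI §5.C Lemma S3 (‖P_{p₁} ⊗ ⋯ ⊗ P_{p_k}‖²_shadow = 3^k)] -/
theorem expect_pauliEst_sq (ρ : Matrix (ι → Bool) (ι → Bool) ℂ) (S : ι → Pauli) :
    ∑ b ∈ settings, ∑ s, prob ρ b s * pauliEst S b s ^ 2 =
      3 ^ PauliPath.strWeight S * ρ.trace := by
  have hsq : ∀ (b : ι → Pauli) (s : ι → Bool), pauliEst S b s ^ 2 =
      ∏ i, (if S i = Pauli.I then (1 : ℂ) else if S i = b i then 9 else 0) := by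
    intro b s
    rw [pauliEst, ← Finset.prod_pow]
    refine Finset.prod_congr rfl fun i _ => ?_
    split_ifs
    · simp
    · rw [mul_pow, pow_two (sgn _), sgn_mul_self]; norm_num
    · simp
  simp only [hsq]
  rw [expect_prod ρ (fun i Q t => if S i = Pauli.I then (1 : ℂ) else if S i = Q then 9 else 0)]
  simp only [wire_sq]
  rw [tensorAll_smul_one, Matrix.smul_mul, Matrix.trace_smul, Matrix.one_mul, smul_eq_mul,
    prod_ite_eq_pow_strWeight]

/-- **Variance of the single-shot Pauli estimate**: for `Tr ρ = 1`,
`Σ_{b,s} prob ρ b s · (pauliEst S b s − Tr(σ_S ρ))² = 3^{|S|} − Tr(σ_S ρ)²`.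
[cite: HuangKuengPreskill2020, Supplementary §1.B Lemma S1 with §5.C Lemma S3] -/
theorem variance_pauliEst (ρ : Matrix (ι → Bool) (ι → Bool) ℂ) (hρ : ρ.trace = 1)
    (S : ι → Pauli) :
    ∑ b ∈ settings, ∑ s, prob ρ b s * (pauliEst S b s - pauliCoeff ρ S) ^ 2 =
      3 ^ PauliPath.strWeight S - pauliCoeff ρ S ^ 2 := by
  have h0 := sum_prob ρ; have h1 := expect_pauliEst ρ S; have h2 := expect_pauliEst_sq ρ S
  rw [hρ] at h0 h2
  have hx : ∀ (b : ι → Pauli) (s : ι → Bool),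
      prob ρ b s * (pauliEst S b s - pauliCoeff ρ S) ^ 2 =
        prob ρ b s * pauliEst S b s ^ 2 - 2 * pauliCoeff ρ S * (prob ρ b s * pauliEst S b s) +
          pauliCoeff ρ S ^ 2 * prob ρ b s := by
    intro b s; ring
  simp only [hx, Finset.sum_add_distrib, Finset.sum_sub_distrib, ← Finset.mul_sum, h0, h1, h2]
  ring

/-- Pauli coefficients of a Hermitian matrix are real. [folklore] -/
private theorem star_pauliCoeff_of_isHermitian {ρ : Matrix (ι → Bool) (ι → Bool) ℂ}
    (hρ : ρ.IsHermitian) (S : ι → Pauli) : star (pauliCoeff ρ S) = pauliCoeff ρ S := by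
  rw [pauliCoeff_eq, ← Matrix.trace_conjTranspose, Matrix.conjTranspose_mul, hρ.eq,
    conjTranspose_pauliString, Matrix.trace_mul_comm]

/-- **Variance bound** `Var[Tr(σ_S ρ̂)] ≤ 3^{|S|}` for a Hermitian unit-trace `ρ` — the shadow-norm
bound that feeds the `O(3^k log(M)/ε²)` sample count for `k`-local Pauli observables.
[cite: HuangKuengPreskill2020, SI §1.B Lemma S1 with §5.C Lemma S3; main text Theorem 1] -/
theorem variance_pauliEst_re_le (ρ : Matrix (ι → Bool) (ι → Bool) ℂ) (hρ : ρ.trace = 1)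
    (hH : ρ.IsHermitian) (S : ι → Pauli) :
    (∑ b ∈ settings, ∑ s, prob ρ b s * (pauliEst S b s - pauliCoeff ρ S) ^ 2).re ≤
      3 ^ PauliPath.strWeight S := by
  rw [variance_pauliEst ρ hρ S, Complex.sub_re]
  have him : (pauliCoeff ρ S).im = 0 := by
    have h := congrArg Complex.im (star_pauliCoeff_of_isHermitian hH S)
    rw [Complex.star_def, Complex.conj_im] at h
    linarith
  have hre : (3 ^ PauliPath.strWeight S : ℂ).re = 3 ^ PauliPath.strWeight S := by
    rw [show (3 : ℂ) = ((3 : ℝ) : ℂ) by norm_num, ← Complex.ofReal_pow, Complex.ofReal_re]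
  have hsq : 0 ≤ (pauliCoeff ρ S ^ 2).re := by
    rw [sq, Complex.mul_re, him, mul_zero, sub_zero]
    exact mul_self_nonneg _
  linarith

end PauliShadow

end Literature.InformationTheory.QuantumLearning
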